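import Summits.NavierStokesRegularity.NavierStokesRegularity.Theorems.CorkscrewDynamoCorkscrewProfileGaussianAngularMomentumTools
import Summits.NavierStokesRegularity.NavierStokesRegularity.Theorems.CorkscrewDynamoCorkscrewProfileGaussianDivergenceIBP
import Summits.NavierStokesRegularity.NavierStokesRegularity.Theorems.CorkscrewDynamoCorkscrewProfileGaussianPolyIntegrable
import HarnessLib

/-!
# Route CorkscrewDynamo · crux `CorkscrewProfile` (stmt-NavierStokesRegularity-11282) — the Gaussian angular-momentum identity (stub W3)

Stub `gaussian_angularMomentum_eq_lambTorque` of line `registered` (skeleton v14, lead c6, wave 3).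

For a smooth solution `(U, P)` of PERELMAN'S ROTATED LERAY PROFILE SYSTEM
`α (J U − DU[J y]) + ½U + ½DU[y] − ΔU + DU[U] + ∇P = 0`, `div U = 0` on `ℝ³`
(`J = rotGen = e₃ × ·`), with `U`, `DU` and `D curl U` polynomially bounded, the Gaussian angular
momentum about the rotation axis equals the Gaussian torque of the Lamb vector:

  `∫ e^{−|y|²/4} ⟪Jy, U⟫ dy = ∫ e^{−|y|²/4} ⟪Jy, U × curl U⟫ dy`

(the angular velocity `α` drops out). Write `G(y) = e^{−|y|²/4}` (`∇G = −½ G y`), `ω = curl U`,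
`ω₃ = (curl U ·) 2`, `U₃ = (U ·) 2`, `b = U + ½y − αJy`.

Proof. Three applications of the Gaussian integration by parts `∫ G div F = ½ ∫ G ⟪y, F⟫`
(W1, `stub_gaussianDivergenceIBP`), every integrand being `G ×` (continuous, polynomially bounded),
hence integrable (W2, `stub_gaussianPolyIntegrable`):
* to the vertical-vorticity flux `F = ω₃ b − ∇ω₃ − U₃ ω`, whose divergence is `½ ω₃`
  (`divergence_verticalVorticityFlux`: V2 `stub_verticalVorticityDivergenceForm` and the
  `e₃`-component of the vorticity equation V1 `stub_rotatedVorticityEq`), with `⟪y, F⟫ = ω₃ ⟪y, U⟫ + ½ ω₃ |y|² − ⟪y, ∇ω₃⟫ − U₃ ⟪y, ω⟫`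
  (`⟪y, Jy⟫ = 0`): `∫ G ω₃ = ∫ G (ω₃ ⟪y, U⟫ + ½ ω₃ |y|² − ⟪y, ∇ω₃⟫ − U₃ ⟪y, ω⟫)`;
* to `ω₃ y` (`div (ω₃ y) = 3ω₃ + ⟪y, ∇ω₃⟫`, `⟪y, ω₃ y⟫ = ω₃ |y|²`):
  `∫ G (3 ω₃ + ⟪y, ∇ω₃⟫) = ½ ∫ G ω₃ |y|²`;
* to `J U` (`div (J U) = tr (J DU) = −ω₃`, `⟪y, J U⟫ = −⟪Jy, U⟫`): `∫ G ω₃ = ½ ∫ G ⟪Jy, U⟫`.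
Eliminating `∫ G ⟪y, ∇ω₃⟫` from the first two gives `2 ∫ G ω₃ = ∫ G (U₃ ⟪y, ω⟫ − ω₃ ⟪y, U⟫)`, and
pointwise `U₃ ⟪y, ω⟫ − ω₃ ⟪y, U⟫ = ⟪Jy, U × ω⟫`; the third identity concludes. The pointwise algebra,
the calculus identities and the polynomial bounds are in the helper file
`CorkscrewDynamoCorkscrewProfileGaussianAngularMomentumTools.lean`; this file proves the integrability
of every Gaussian integrand, the three integrations by parts and the registered stub.
-/

noncomputable section

open MeasureTheory InnerProductSpace
open Literature.Analysis.FluidPDE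
open scoped RealInnerProductSpace Laplacian

namespace Summit.NavierStokesRegularity.NavierStokesRegularity.Theorems.CorkscrewProfile.Birth

set_option linter.dupNamespace false

/-! ### Gaussian integrability of the integrands -/

section Integrability

variable {α K : ℝ} {N : ℕ} {U : EuclideanSpace ℝ (Fin 3) → EuclideanSpace ℝ (Fin 3)}

/-- `G ω₃ ∈ L¹` (`G(y) = e^{−‖y‖²/4}`; `ω₃` continuous with `|ω₃| ≤ ‖curlCLM‖ K (1+‖y‖)ᴺ`, W2). [folklore] -/
theorem integrable_gaussian_mul_curl_two (hU : ContDiff ℝ (⊤ : ℕ∞) U)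
    (hD1 : ∀ y : EuclideanSpace ℝ (Fin 3), ‖fderiv ℝ U y‖ ≤ K * (1 + ‖y‖) ^ N) :
    Integrable (fun y : EuclideanSpace ℝ (Fin 3) => Real.exp (-‖y‖ ^ 2 / 4) * curl U y 2) :=
  gaussianPolyIntegrable_mul (smooth_regularity_package hU).2.2.2.2.1.aestronglyMeasurable
    (norm_curl_two_le_poly hD1)

/-- `G ω₃ ⟪y, U⟫ ∈ L¹` (continuous, `≤ ‖curlCLM‖ K² (1+‖y‖)^{2N+1}`, W2). [folklore] -/
theorem integrable_gaussian_mul_curl_two_mul_inner_self (hU : ContDiff ℝ (⊤ : ℕ∞) U)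
    (hUb : ∀ y : EuclideanSpace ℝ (Fin 3), ‖U y‖ ≤ K * (1 + ‖y‖) ^ N)
    (hD1 : ∀ y : EuclideanSpace ℝ (Fin 3), ‖fderiv ℝ U y‖ ≤ K * (1 + ‖y‖) ^ N) :
    Integrable (fun y : EuclideanSpace ℝ (Fin 3) =>
      Real.exp (-‖y‖ ^ 2 / 4) * (curl U y 2 * ⟪y, U y⟫)) := by
  obtain ⟨-, -, cU, -, cω₃, -, -⟩ := smooth_regularity_package hU
  exact gaussianPolyIntegrable_mul (cω₃.mul (continuous_id.inner cU)).aestronglyMeasurable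
    fun y => le_mul_mul_pow_add (norm_mul_le _ _) (norm_nonneg _) (norm_nonneg _)
      (norm_curl_two_le_poly hD1 y)
      (le_mul_mul_pow_add (norm_inner_le_norm _ _) (norm_nonneg _) (norm_nonneg _)
        (norm_le_one_mul_one_add_norm_pow_one y) (hUb y))

/-- `G ω₃ ‖y‖² ∈ L¹` (continuous, `≤ ‖curlCLM‖ K (1+‖y‖)^{N+2}`, W2). [folklore] -/
theorem integrable_gaussian_mul_curl_two_mul_norm_sq (hU : ContDiff ℝ (⊤ : ℕ∞) U)
    (hD1 : ∀ y : EuclideanSpace ℝ (Fin 3), ‖fderiv ℝ U y‖ ≤ K * (1 + ‖y‖) ^ N) :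
    Integrable (fun y : EuclideanSpace ℝ (Fin 3) =>
      Real.exp (-‖y‖ ^ 2 / 4) * (curl U y 2 * ‖y‖ ^ 2)) := by
  obtain ⟨-, -, -, -, cω₃, -, -⟩ := smooth_regularity_package hU
  exact gaussianPolyIntegrable_mul (cω₃.mul (continuous_norm.pow 2)).aestronglyMeasurable
    fun y => le_mul_mul_pow_add (norm_mul_le _ _) (norm_nonneg _) (norm_nonneg _)
      (norm_curl_two_le_poly hD1 y)
      (le_mul_mul_pow_add (by rw [Real.norm_of_nonneg (sq_nonneg _), sq]) (norm_nonneg _)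
        (norm_nonneg _) (norm_le_one_mul_one_add_norm_pow_one y)
        (norm_le_one_mul_one_add_norm_pow_one y))

/-- `G ⟪y, ∇ω₃⟫ ∈ L¹` (continuous, `≤ K (1+‖y‖)^{N+1}`, W2). [folklore] -/
theorem integrable_gaussian_mul_inner_self_gradient_curl_two (hU : ContDiff ℝ (⊤ : ℕ∞) U)
    (hD2 : ∀ y : EuclideanSpace ℝ (Fin 3), ‖fderiv ℝ (curl U) y‖ ≤ K * (1 + ‖y‖) ^ N) :
    Integrable (fun y : EuclideanSpace ℝ (Fin 3) =>
      Real.exp (-‖y‖ ^ 2 / 4) * ⟪y, gradient (fun w => curl U w 2) y⟫) := by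
  obtain ⟨hω2, -, -, -, -, -, cg⟩ := smooth_regularity_package hU
  exact gaussianPolyIntegrable_mul (continuous_id.inner cg).aestronglyMeasurable
    fun y => le_mul_mul_pow_add (norm_inner_le_norm _ _) (norm_nonneg _) (norm_nonneg _)
      (norm_le_one_mul_one_add_norm_pow_one y)
      (norm_gradient_curl_two_le_poly (hω2.differentiable two_ne_zero) hD2 y)

/-- `G U₃ ⟪y, ω⟫ ∈ L¹` (continuous, `≤ ‖curlCLM‖ K² (1+‖y‖)^{2N+1}`, W2). [folklore] -/
theorem integrable_gaussian_mul_apply_two_mul_inner_self_curl (hU : ContDiff ℝ (⊤ : ℕ∞) U)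
    (hUb : ∀ y : EuclideanSpace ℝ (Fin 3), ‖U y‖ ≤ K * (1 + ‖y‖) ^ N)
    (hD1 : ∀ y : EuclideanSpace ℝ (Fin 3), ‖fderiv ℝ U y‖ ≤ K * (1 + ‖y‖) ^ N) :
    Integrable (fun y : EuclideanSpace ℝ (Fin 3) =>
      Real.exp (-‖y‖ ^ 2 / 4) * (U y 2 * ⟪y, curl U y⟫)) := by
  obtain ⟨-, -, -, cω, -, cU₃, -⟩ := smooth_regularity_package hU
  exact gaussianPolyIntegrable_mul (cU₃.mul (continuous_id.inner cω)).aestronglyMeasurable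
    fun y => le_mul_mul_pow_add (norm_mul_le _ _) (norm_nonneg _) (norm_nonneg _)
      ((PiLp.norm_apply_le (U y) 2).trans (hUb y))
      (le_mul_mul_pow_add (norm_inner_le_norm _ _) (norm_nonneg _) (norm_nonneg _)
        (norm_le_one_mul_one_add_norm_pow_one y) (norm_curl_le_poly hD1 y))

/-- `G ⟪Jy, U⟫ ∈ L¹` — the Gaussian angular momentum density (continuous, `≤ K (1+‖y‖)^{N+1}`, W2).
[folklore] -/
theorem integrable_gaussian_mul_inner_rotGen (hU : ContDiff ℝ (⊤ : ℕ∞) U)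
    (hUb : ∀ y : EuclideanSpace ℝ (Fin 3), ‖U y‖ ≤ K * (1 + ‖y‖) ^ N) :
    Integrable (fun y : EuclideanSpace ℝ (Fin 3) =>
      Real.exp (-‖y‖ ^ 2 / 4) * ⟪rotGen y, U y⟫) := by
  have cJ : Continuous (fun y : EuclideanSpace ℝ (Fin 3) => rotGen y) := rotGenL.continuous
  exact gaussianPolyIntegrable_mul (cJ.inner hU.continuous).aestronglyMeasurable
    fun y => le_mul_mul_pow_add (norm_inner_le_norm _ _) (norm_nonneg _) (norm_nonneg _)
      (norm_rotGen_le_one_mul_one_add_norm_pow_one y) (hUb y)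

/-- `G • (ω₃ y) ∈ L¹` (continuous, `≤ ‖curlCLM‖ K (1+‖y‖)^{N+1}`, W2). [folklore] -/
theorem integrable_gaussian_smul_curl_two_smul_self (hU : ContDiff ℝ (⊤ : ℕ∞) U)
    (hD1 : ∀ y : EuclideanSpace ℝ (Fin 3), ‖fderiv ℝ U y‖ ≤ K * (1 + ‖y‖) ^ N) :
    Integrable (fun y : EuclideanSpace ℝ (Fin 3) =>
      Real.exp (-‖y‖ ^ 2 / 4) • ((curl U y 2) • y)) := by
  obtain ⟨-, -, -, -, cω₃, -, -⟩ := smooth_regularity_package hU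
  exact gaussianPolyIntegrable_of_continuous (cω₃.smul continuous_id)
    fun y => le_mul_mul_pow_add (norm_smul_le _ _) (norm_nonneg _) (norm_nonneg _)
      (norm_curl_two_le_poly hD1 y) (norm_le_one_mul_one_add_norm_pow_one y)

/-- `G • (J U) ∈ L¹` (continuous, `‖J U‖ ≤ ‖U‖ ≤ K (1+‖y‖)ᴺ`, W2). [folklore] -/
theorem integrable_gaussian_smul_rotGen_comp (hU : ContDiff ℝ (⊤ : ℕ∞) U)
    (hUb : ∀ y : EuclideanSpace ℝ (Fin 3), ‖U y‖ ≤ K * (1 + ‖y‖) ^ N) :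
    Integrable (fun y : EuclideanSpace ℝ (Fin 3) =>
      Real.exp (-‖y‖ ^ 2 / 4) • rotGen (U y)) := by
  have cJU : Continuous (fun y : EuclideanSpace ℝ (Fin 3) => rotGen (U y)) :=
    rotGenL.continuous.comp hU.continuous
  exact gaussianPolyIntegrable_of_continuous cJU
    fun y => (PineauVicol2026.norm_rotGen_le _).trans (hUb y)

/-- `G • F ∈ L¹` for the vertical-vorticity flux `F = ω₃ b − ∇ω₃ − U₃ ω` (continuous for `U ∈ C³`,
polynomially bounded, W2). [folklore] -/
theorem integrable_gaussian_smul_verticalVorticityFlux (hU : ContDiff ℝ (⊤ : ℕ∞) U)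
    (hUb : ∀ y : EuclideanSpace ℝ (Fin 3), ‖U y‖ ≤ K * (1 + ‖y‖) ^ N)
    (hD1 : ∀ y : EuclideanSpace ℝ (Fin 3), ‖fderiv ℝ U y‖ ≤ K * (1 + ‖y‖) ^ N)
    (hD2 : ∀ y : EuclideanSpace ℝ (Fin 3), ‖fderiv ℝ (curl U) y‖ ≤ K * (1 + ‖y‖) ^ N) :
    Integrable (fun y : EuclideanSpace ℝ (Fin 3) => Real.exp (-‖y‖ ^ 2 / 4) •
      ((curl U y 2) • (U y + (1 / 2 : ℝ) • y - α • rotGen y) - gradient (fun w => curl U w 2) y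
          - (U y 2) • curl U y)) := by
  have hU3 : ContDiff ℝ 3 U := hU.of_le (WithTop.coe_le_coe.2 le_top)
  obtain ⟨C, M, hb⟩ := norm_verticalVorticityFlux_le_poly (α := α) hU hUb hD1 hD2
  exact gaussianPolyIntegrable_of_continuous (contDiff_verticalVorticityFlux (α := α) hU3).continuous
    hb

end Integrability

/-! ### The three Gaussian integrations by parts -/

section Identities

variable {α K : ℝ} {N : ℕ} {U : EuclideanSpace ℝ (Fin 3) → EuclideanSpace ℝ (Fin 3)}
  {P : EuclideanSpace ℝ (Fin 3) → ℝ}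

/-- **W1 on `J U`: `∫ G ω₃ = ½ ∫ G ⟪Jy, U⟫`** (`div (J U) = −ω₃`, `⟪y, J U⟫ = −⟪Jy, U⟫`). [folklore] -/
theorem integral_gaussian_curl_two_eq_half_angularMomentum (hU : ContDiff ℝ (⊤ : ℕ∞) U)
    (hUb : ∀ y : EuclideanSpace ℝ (Fin 3), ‖U y‖ ≤ K * (1 + ‖y‖) ^ N)
    (hD1 : ∀ y : EuclideanSpace ℝ (Fin 3), ‖fderiv ℝ U y‖ ≤ K * (1 + ‖y‖) ^ N) :
    ∫ y, Real.exp (-‖y‖ ^ 2 / 4) * curl U y 2 =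
      (1 / 2 : ℝ) * ∫ y, Real.exp (-‖y‖ ^ 2 / 4) * ⟪rotGen y, U y⟫ := by
  have hU1 : ContDiff ℝ 1 U := hU.of_le (WithTop.coe_le_coe.2 le_top)
  have hUd : Differentiable ℝ U := hU1.differentiable one_ne_zero
  have hF : ContDiff ℝ 1 (fun y => rotGen (U y)) := rotGenL.contDiff.comp hU1
  have hdivJ : ∀ y, VectorCalculus.divergence (fun z => rotGen (U z)) y = -(curl U y 2) :=
    divergence_rotGen_comp_eq_neg_curl_two hUd
  have i1 := integrable_gaussian_mul_curl_two hU hD1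
  have i6 := integrable_gaussian_mul_inner_rotGen hU hUb
  have hGdiv : Integrable (fun y : EuclideanSpace ℝ (Fin 3) =>
      Real.exp (-‖y‖ ^ 2 / 4) * VectorCalculus.divergence (fun z => rotGen (U z)) y) := by
    have : (fun y : EuclideanSpace ℝ (Fin 3) =>
        Real.exp (-‖y‖ ^ 2 / 4) * VectorCalculus.divergence (fun z => rotGen (U z)) y) =
        fun y => -(Real.exp (-‖y‖ ^ 2 / 4) * curl U y 2) := by
      funext y; rw [hdivJ]; ring
    rw [this]; exact i1.neg
  have hGyF : Integrable (fun y : EuclideanSpace ℝ (Fin 3) =>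
      Real.exp (-‖y‖ ^ 2 / 4) * ⟪y, rotGen (U y)⟫) := by
    have : (fun y : EuclideanSpace ℝ (Fin 3) => Real.exp (-‖y‖ ^ 2 / 4) * ⟪y, rotGen (U y)⟫) =
        fun y => -(Real.exp (-‖y‖ ^ 2 / 4) * ⟪rotGen y, U y⟫) := by
      funext y; rw [inner_rotGen_right_eq_neg_inner_rotGen_left]; ring
    rw [this]; exact i6.neg
  have key := stub_gaussianDivergenceIBP hF (integrable_gaussian_smul_rotGen_comp hU hUb) hGdiv hGyF
  simp only [hdivJ, inner_rotGen_right_eq_neg_inner_rotGen_left, mul_neg, integral_neg] at key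
  linarith

/-- **W1 on `ω₃ y`: `3 ∫ G ω₃ + ∫ G ⟪y, ∇ω₃⟫ = ½ ∫ G ω₃ ‖y‖²`** (`div (ω₃ y) = 3ω₃ + ⟪y, ∇ω₃⟫`,
`⟪y, ω₃ y⟫ = ω₃ ‖y‖²`). [folklore] -/
theorem integral_gaussian_divergence_curl_two_smul_self (hU : ContDiff ℝ (⊤ : ℕ∞) U)
    (hD1 : ∀ y : EuclideanSpace ℝ (Fin 3), ‖fderiv ℝ U y‖ ≤ K * (1 + ‖y‖) ^ N)
    (hD2 : ∀ y : EuclideanSpace ℝ (Fin 3), ‖fderiv ℝ (curl U) y‖ ≤ K * (1 + ‖y‖) ^ N) :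
    3 * (∫ y, Real.exp (-‖y‖ ^ 2 / 4) * curl U y 2) +
        (∫ y, Real.exp (-‖y‖ ^ 2 / 4) * ⟪y, gradient (fun w => curl U w 2) y⟫) =
      (1 / 2 : ℝ) * ∫ y, Real.exp (-‖y‖ ^ 2 / 4) * (curl U y 2 * ‖y‖ ^ 2) := by
  obtain ⟨-, hω₃1, -, -, -, -, -⟩ := smooth_regularity_package hU
  have hω₃d : Differentiable ℝ (fun w => curl U w 2) := hω₃1.differentiable one_ne_zero
  have hF : ContDiff ℝ 1 (fun y : EuclideanSpace ℝ (Fin 3) => (curl U y 2) • y) :=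
    hω₃1.smul contDiff_id
  have hdivH : ∀ y, VectorCalculus.divergence (fun z : EuclideanSpace ℝ (Fin 3) => (curl U z 2) • z) y
      = 3 * curl U y 2 + ⟪y, gradient (fun w => curl U w 2) y⟫ := fun y =>
    divergence_smul_self_eq (hω₃d y)
  have hyH : ∀ y : EuclideanSpace ℝ (Fin 3), ⟪y, (curl U y 2) • y⟫ = curl U y 2 * ‖y‖ ^ 2 :=
    fun y => by rw [real_inner_smul_right, real_inner_self_eq_norm_sq]
  have i1 := integrable_gaussian_mul_curl_two hU hD1
  have i3 := integrable_gaussian_mul_curl_two_mul_norm_sq hU hD1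
  have i4 := integrable_gaussian_mul_inner_self_gradient_curl_two hU hD2
  have hsplit : (fun y : EuclideanSpace ℝ (Fin 3) => Real.exp (-‖y‖ ^ 2 / 4) *
      VectorCalculus.divergence (fun z : EuclideanSpace ℝ (Fin 3) => (curl U z 2) • z) y) =
      fun y => 3 * (Real.exp (-‖y‖ ^ 2 / 4) * curl U y 2)
        + Real.exp (-‖y‖ ^ 2 / 4) * ⟪y, gradient (fun w => curl U w 2) y⟫ := by
    funext y; rw [hdivH]; ring
  have hGdiv : Integrable (fun y : EuclideanSpace ℝ (Fin 3) => Real.exp (-‖y‖ ^ 2 / 4) *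
      VectorCalculus.divergence (fun z : EuclideanSpace ℝ (Fin 3) => (curl U z 2) • z) y) := by
    rw [hsplit]; exact (i1.const_mul 3).fun_add i4
  have hGyF : Integrable (fun y : EuclideanSpace ℝ (Fin 3) =>
      Real.exp (-‖y‖ ^ 2 / 4) * ⟪y, (curl U y 2) • y⟫) := by
    simp_rw [hyH]; exact i3
  have key := stub_gaussianDivergenceIBP hF (integrable_gaussian_smul_curl_two_smul_self hU hD1)
    hGdiv hGyF
  rw [hsplit, integral_add (i1.const_mul 3) i4, integral_const_mul] at key
  simp_rw [hyH] at key
  exact key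

/-- **W1 on the vertical-vorticity flux: `½ ∫ G ω₃ = ½ ∫ G ⟪y, F⟫`, expanded** —
`∫ G div F = ½ ∫ G ⟪y, F⟫` with `div F = ½ ω₃` (`divergence_verticalVorticityFlux`) and
`⟪y, F⟫ = ω₃ ⟪y, U⟫ + ½ ω₃ ‖y‖² − ⟪y, ∇ω₃⟫ − U₃ ⟪y, ω⟫`. [folklore] -/
theorem integral_gaussian_curl_two_eq_flux_pairing (hU : ContDiff ℝ (⊤ : ℕ∞) U)
    (hP : ContDiff ℝ (⊤ : ℕ∞) P) (hdiv : VectorCalculus.IsDivFree U)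
    (heq : ∀ y : EuclideanSpace ℝ (Fin 3),
      α • (rotGen (U y) - fderiv ℝ U y (rotGen y)) + (1 / 2 : ℝ) • U y + (1 / 2 : ℝ) • fderiv ℝ U y y
        - (Δ U) y + fderiv ℝ U y (U y) + gradient P y = 0)
    (hUb : ∀ y : EuclideanSpace ℝ (Fin 3), ‖U y‖ ≤ K * (1 + ‖y‖) ^ N)
    (hD1 : ∀ y : EuclideanSpace ℝ (Fin 3), ‖fderiv ℝ U y‖ ≤ K * (1 + ‖y‖) ^ N)
    (hD2 : ∀ y : EuclideanSpace ℝ (Fin 3), ‖fderiv ℝ (curl U) y‖ ≤ K * (1 + ‖y‖) ^ N) :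
    (1 / 2 : ℝ) * (∫ y, Real.exp (-‖y‖ ^ 2 / 4) * curl U y 2) =
      (1 / 2 : ℝ) * ((∫ y, Real.exp (-‖y‖ ^ 2 / 4) * (curl U y 2 * ⟪y, U y⟫))
        + (1 / 2 : ℝ) * (∫ y, Real.exp (-‖y‖ ^ 2 / 4) * (curl U y 2 * ‖y‖ ^ 2))
        - (∫ y, Real.exp (-‖y‖ ^ 2 / 4) * ⟪y, gradient (fun w => curl U w 2) y⟫)
        - (∫ y, Real.exp (-‖y‖ ^ 2 / 4) * (U y 2 * ⟪y, curl U y⟫))) := by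
  have hU3 : ContDiff ℝ 3 U := hU.of_le (WithTop.coe_le_coe.2 le_top)
  set F : EuclideanSpace ℝ (Fin 3) → EuclideanSpace ℝ (Fin 3) := fun z =>
    (curl U z 2) • (U z + (1 / 2 : ℝ) • z - α • rotGen z) - gradient (fun w => curl U w 2) z
      - (U z 2) • curl U z with hFdef
  have hFc : ContDiff ℝ 1 F := contDiff_verticalVorticityFlux (α := α) hU3
  have hdivF : ∀ y, VectorCalculus.divergence F y = (1 / 2 : ℝ) * curl U y 2 :=
    divergence_verticalVorticityFlux hU hP hdiv heq
  have hyF : ∀ y : EuclideanSpace ℝ (Fin 3), ⟪y, F y⟫ = curl U y 2 * ⟪y, U y⟫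
      + (1 / 2 : ℝ) * (curl U y 2 * ‖y‖ ^ 2) - ⟪y, gradient (fun w => curl U w 2) y⟫
      - U y 2 * ⟪y, curl U y⟫ := fun y =>
    inner_self_verticalVorticityFlux_eq α (curl U y 2) (U y 2) y (U y)
      (gradient (fun w => curl U w 2) y) (curl U y)
  have i1 := integrable_gaussian_mul_curl_two hU hD1
  have i2 := integrable_gaussian_mul_curl_two_mul_inner_self hU hUb hD1
  have i3 := integrable_gaussian_mul_curl_two_mul_norm_sq hU hD1
  have i4 := integrable_gaussian_mul_inner_self_gradient_curl_two hU hD2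
  have i5 := integrable_gaussian_mul_apply_two_mul_inner_self_curl hU hUb hD1
  have iF : Integrable (fun y : EuclideanSpace ℝ (Fin 3) => Real.exp (-‖y‖ ^ 2 / 4) • F y) :=
    integrable_gaussian_smul_verticalVorticityFlux (α := α) hU hUb hD1 hD2
  have hL : (fun y : EuclideanSpace ℝ (Fin 3) => Real.exp (-‖y‖ ^ 2 / 4) * VectorCalculus.divergence F y)
      = fun y => (1 / 2 : ℝ) * (Real.exp (-‖y‖ ^ 2 / 4) * curl U y 2) := by
    funext y; rw [hdivF]; ring
  have hR : (fun y : EuclideanSpace ℝ (Fin 3) => Real.exp (-‖y‖ ^ 2 / 4) * ⟪y, F y⟫)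
      = fun y => Real.exp (-‖y‖ ^ 2 / 4) * (curl U y 2 * ⟪y, U y⟫)
        + (1 / 2 : ℝ) * (Real.exp (-‖y‖ ^ 2 / 4) * (curl U y 2 * ‖y‖ ^ 2))
        - Real.exp (-‖y‖ ^ 2 / 4) * ⟪y, gradient (fun w => curl U w 2) y⟫
        - Real.exp (-‖y‖ ^ 2 / 4) * (U y 2 * ⟪y, curl U y⟫) := by
    funext y; rw [hyF]; ring
  have hGdiv : Integrable (fun y : EuclideanSpace ℝ (Fin 3) =>
      Real.exp (-‖y‖ ^ 2 / 4) * VectorCalculus.divergence F y) := by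
    rw [hL]; exact i1.const_mul _
  have hGyF : Integrable (fun y : EuclideanSpace ℝ (Fin 3) => Real.exp (-‖y‖ ^ 2 / 4) * ⟪y, F y⟫) := by
    rw [hR]; exact ((i2.fun_add (i3.const_mul (1 / 2 : ℝ))).sub' i4).sub' i5
  have key := stub_gaussianDivergenceIBP hFc iF hGdiv hGyF
  rw [hL, hR, integral_const_mul, integral_sub ((i2.fun_add (i3.const_mul (1 / 2 : ℝ))).sub' i4) i5,
    integral_sub (i2.fun_add (i3.const_mul (1 / 2 : ℝ))) i4, integral_add i2 (i3.const_mul (1 / 2 : ℝ)),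
    integral_const_mul] at key
  exact key

/-- **The Gaussian Lamb torque, split**: `∫ G ⟪Jy, U × ω⟫ = ∫ G U₃ ⟪y, ω⟫ − ∫ G ω₃ ⟪y, U⟫`
(`⟪Jy, U × ω⟫ = U₃ ⟪y, ω⟫ − ω₃ ⟪y, U⟫` pointwise, both pieces integrable). [folklore] -/
theorem integral_gaussian_lambTorque_eq_sub (hU : ContDiff ℝ (⊤ : ℕ∞) U)
    (hUb : ∀ y : EuclideanSpace ℝ (Fin 3), ‖U y‖ ≤ K * (1 + ‖y‖) ^ N)
    (hD1 : ∀ y : EuclideanSpace ℝ (Fin 3), ‖fderiv ℝ U y‖ ≤ K * (1 + ‖y‖) ^ N) :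
    ∫ y, Real.exp (-‖y‖ ^ 2 / 4) * ⟪rotGen y, cross (U y) (curl U y)⟫ =
      (∫ y, Real.exp (-‖y‖ ^ 2 / 4) * (U y 2 * ⟪y, curl U y⟫))
        - (∫ y, Real.exp (-‖y‖ ^ 2 / 4) * (curl U y 2 * ⟪y, U y⟫)) := by
  have h : (fun y : EuclideanSpace ℝ (Fin 3) =>
      Real.exp (-‖y‖ ^ 2 / 4) * ⟪rotGen y, cross (U y) (curl U y)⟫) =
      fun y => Real.exp (-‖y‖ ^ 2 / 4) * (U y 2 * ⟪y, curl U y⟫)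
        - Real.exp (-‖y‖ ^ 2 / 4) * (curl U y 2 * ⟪y, U y⟫) := by
    funext y; rw [inner_rotGen_cross_eq_sub, mul_sub]
  rw [h, integral_sub (integrable_gaussian_mul_apply_two_mul_inner_self_curl hU hUb hD1)
    (integrable_gaussian_mul_curl_two_mul_inner_self hU hUb hD1)]

end Identities

/-! ### The registered stub W3 -/

/-- **Stub W3 `gaussian_angularMomentum_eq_lambTorque` — the Gaussian angular-momentum identity.**
For a smooth solution `(U, P)` of Perelman's rotated Leray profile system
`α (J U − DU[J y]) + ½U + ½DU[y] − ΔU + DU[U] + ∇P = 0`, `div U = 0` (any `α ∈ ℝ`, `J = rotGen`)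
with `U`, `DU`, `D curl U` polynomially bounded,
`∫ e^{−|y|²/4} ⟪Jy, U⟫ dy = ∫ e^{−|y|²/4} ⟪Jy, U × curl U⟫ dy`:
the Gaussian integration by parts W1 applied to the vertical-vorticity flux
`F = ω₃ b − ∇ω₃ − U₃ ω` (`div F = ½ ω₃`), to `ω₃ y` and to `J U` (`div (J U) = −ω₃`), W2 for every
integrability, `⟪y, Jy⟫ = 0` and `U₃ ⟪y, ω⟫ − ω₃ ⟪y, U⟫ = ⟪Jy, U × ω⟫`. [folklore] -/
theorem gaussian_angularMomentum_eq_lambTorque {α K : ℝ} {N : ℕ}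
    {U : EuclideanSpace ℝ (Fin 3) → EuclideanSpace ℝ (Fin 3)} {P : EuclideanSpace ℝ (Fin 3) → ℝ}
    (hU : ContDiff ℝ (⊤ : ℕ∞) U) (hP : ContDiff ℝ (⊤ : ℕ∞) P) (hdiv : VectorCalculus.IsDivFree U)
    (heq : ∀ y : EuclideanSpace ℝ (Fin 3),
      α • (rotGen (U y) - fderiv ℝ U y (rotGen y)) + (1 / 2 : ℝ) • U y + (1 / 2 : ℝ) • fderiv ℝ U y y
        - (Δ U) y + fderiv ℝ U y (U y) + gradient P y = 0)
    (hUb : ∀ y : EuclideanSpace ℝ (Fin 3), ‖U y‖ ≤ K * (1 + ‖y‖) ^ N)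
    (hD1 : ∀ y : EuclideanSpace ℝ (Fin 3), ‖fderiv ℝ U y‖ ≤ K * (1 + ‖y‖) ^ N)
    (hD2 : ∀ y : EuclideanSpace ℝ (Fin 3), ‖fderiv ℝ (curl U) y‖ ≤ K * (1 + ‖y‖) ^ N) :
    ∫ y, Real.exp (-‖y‖ ^ 2 / 4) * ⟪rotGen y, U y⟫ =
      ∫ y, Real.exp (-‖y‖ ^ 2 / 4) * ⟪rotGen y, cross (U y) (curl U y)⟫ := by
  have e1 := integral_gaussian_curl_two_eq_flux_pairing hU hP hdiv heq hUb hD1 hD2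
  have e2 := integral_gaussian_divergence_curl_two_smul_self hU hD1 hD2
  have e3 := integral_gaussian_curl_two_eq_half_angularMomentum hU hUb hD1
  have e4 := integral_gaussian_lambTorque_eq_sub hU hUb hD1
  linarith

end Summit.NavierStokesRegularity.NavierStokesRegularity.Theorems.CorkscrewProfile.Birth

end
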